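import Summits.Parity.GeneralizedHardyLittlewood.Theses.LeeYangFibres
import Summits.Parity.GeneralizedHardyLittlewood.Theorems.LeeYangFibresCellParityLawDefs
import Summits.Parity.GeneralizedHardyLittlewood.Theorems.LeeYangFibresCellParityLawKernelDefs
import Summits.Parity.GeneralizedHardyLittlewood.Theorems.LeeYangFibresCellParityLawModelDensityBounds
import Summits.Parity.GeneralizedHardyLittlewood.Theorems.LeeYangFibresCellParityLawSingularRatio
import Summits.Parity.GeneralizedHardyLittlewood.Theorems.LeeYangFibresCellParityLawWalshStep
import Summits.Parity.GeneralizedHardyLittlewood.Theorems.LeeYangFibresCellParityLawBase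
import Summits.Parity.GeneralizedHardyLittlewood.Theorems.LeeYangFibresCellParityLawReduction
import Summits.Parity.GeneralizedHardyLittlewood.Theorems.LeeYangFibresCellParityLawPrConversion
import Summits.Parity.GeneralizedHardyLittlewood.Theorems.LeeYangFibresCellParityLawEulerRatio
import Summits.Parity.GeneralizedHardyLittlewood.Theorems.LeeYangFibresCellParityLawSieveDefs
import Summits.Parity.GeneralizedHardyLittlewood.Theorems.LeeYangFibresCellParityLawSeqFacts
import Summits.Parity.GeneralizedHardyLittlewood.Theorems.LeeYangFibresCellParityLawDimension
import Summits.Parity.GeneralizedHardyLittlewood.Theorems.LeeYangFibresCellParityLawDimensionLow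
import Summits.Parity.GeneralizedHardyLittlewood.Theorems.LeeYangFibresCellParityLawMertens
import Summits.Parity.GeneralizedHardyLittlewood.Theorems.LeeYangFibresCellParityLawMertensLowerHead
import Summits.Parity.GeneralizedHardyLittlewood.Theorems.LeeYangFibresCellParityLawMertensTwo
import Summits.Parity.GeneralizedHardyLittlewood.Theorems.LeeYangFibresCellParityLawAlladi
import Summits.Parity.GeneralizedHardyLittlewood.Theorems.LeeYangFibresCellParityLawMainTerm
import Summits.Parity.GeneralizedHardyLittlewood.Theorems.LeeYangFibresCellParityLawSeqBFacts
import Summits.Parity.GeneralizedHardyLittlewood.Theorems.LeeYangFibresCellParityLawSeqBCells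
import Summits.Parity.GeneralizedHardyLittlewood.Theorems.LeeYangFibresCellParityLawGeThreeHyp
import Summits.Parity.GeneralizedHardyLittlewood.Theorems.LeeYangFibresCellParityLawGeThreeReduce
import Summits.Parity.GeneralizedHardyLittlewood.Theorems.LeeYangFibresCellParityLawGeThreeAssembly
import Summits.Parity.GeneralizedHardyLittlewood.Theorems.LeeYangFibresCellParityLawPrLawTwoPrep
import Summits.Parity.GeneralizedHardyLittlewood.Theorems.LeeYangFibresCellParityLawPrLawTwoTopCell
import Summits.Parity.GeneralizedHardyLittlewood.Theorems.LeeYangFibresCellParityLawPrLawTwoMainCell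
import Summits.Parity.GeneralizedHardyLittlewood.Theorems.LeeYangFibresCellParityLawPrLawTwoAssembly
import Summits.Parity.GeneralizedHardyLittlewood.Theorems.LeeYangFibresCellParityLawLayerOne
import HarnessLib

/-!
# Route `LeeYangFibres`, crux `CellParityLaw` (stmt-Parity-14109), line `section-annihilator`:
# the conditional closure of the crux on the atom and the kernel

**Theorem (sorry-free, CONDITIONAL on two named statements).**
`cellParityLaw_of_atom_of_kernel : (∀ t ≥ 1, SectionLevelAt t) → EffectiveRoughCellLaw → CellParityLaw`.

The two hypotheses are the only registered stubs of the line's skeleton v15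
(`Cruxes/CellParityLaw/Lines/section_annihilator.lean`) that are not landed theorems:

* `SectionLevelAt t` (`LeeYangFibresCellParityLawDefs`): the conjectural Type-I ATOM — Bombieri's `(A₂)` for
  every coordinate section sequence of a non-degenerate `(t+1)`-form system, exact rough-supported density
  `sectionDensity`, level `N^{1-(log log N)^{-B}}`, saving `(log N)^{-A}`, all `A, B` (typed tuple-GEH; an
  Elliott–Halberstam-type statement already at `t = 1`; a conjecture by design of the route, NOT a fact);
* `EffectiveRoughCellLaw` (`LeeYangFibresCellParityLawKernelDefs`): the KERNEL — the effective (polynomial-rate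
  in the level deficit) form of Bombieri's asymptotic-sieve completeness theorem for the rough `Ω`-cells of ONE
  sifted sequence at finite level (crux-independent research statement; printed technology —
  Friedlander–Iwaniec 1978 §4 and Bombieri 1977 — gives the law qualitatively).

Everything else is composed BY NAME from accepted theorems: the `u = 2` rung of Bombieri's `P_r` law for the
sections (`stub_prLawTwoAssembly` fed by SeqFacts/Dimension/Mertens/EulerRatio/Prep/TopCell/MainCell —
Iwaniec's linear sieve at `s = 2`), the `u ≥ 3` rung (`stub_geThreeCompose` fed by the kernel and the eleven
landed glue stubs SeqBFacts/SeqBCells/Dimension/DimensionLow/MertensLowerHead/MertensTwo/Alladi/Prep/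
EulerRatio/GeThreeHyp/GeThreeReduce/GeThreeMainTerm/GeThreeAssembly), the case split `stub_prLawCases`, the
conversion `stub_lawOfPrLaw`, the engine bookkeeping `stub_engineCompose` and the reduction `stub_reduction`
(Walsh/tensor induction on the number of forms from the unconditional base `stub_base : LawEffAt 1`).

What this records for the route: the crux `CellParityLaw` is EXACTLY as hard as (atom ∧ kernel); the gate
files this as a conditional result (`--supports stmt-Parity-14109`), not as a closure of the item.

References: E. Bombieri, Rend. Accad. Naz. XL (5) 1/2 (1975/76) 243–269 [BombieriAsymptoticSieve1976];
E. Bombieri, RIMS Kôkyûroku 294 (1977) p. 5 [BombieriRIMS1977]; J. Friedlander, H. Iwaniec, Ann. Sc. Norm.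
Sup. Pisa (4) 5 (1978) 719–756, §4 [FriedlanderIwaniecPisa1978]; H. Iwaniec, Acta Arith. 36 (1980) Thm 1
[IwaniecActaArith1980]; B. Green, T. Tao, Ann. of Math. 171 (2010) Conj. 1.4 [GreenTao2010].
-/

noncomputable section

open scoped BigOperators Classical
open Finset Literature.NumberTheory.Sieve

namespace Summit.Parity.GeneralizedHardyLittlewood.Cruxes.CellParityLaw.SectionAnnihilator

/-- The `u = 2` rung of Bombieri's `P_r` law for the sections, from its LANDED pieces (Iwaniec's linear sieve
at `s = 2` fed by the atom): `∀ t ≥ 1, SectionLevelAt t → SectionPrLawAtU 2 t`. Unconditional implication. -/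
theorem sectionPrLawTwo_of_atom : ∀ t : ℕ, 1 ≤ t → SectionLevelAt t → SectionPrLawAtU 2 t :=
  stub_prLawTwoAssembly stub_sectionSeqFacts stub_sectionDimension stub_sectionMertens stub_eulerRatio
    stub_prLawTwoPrep stub_prLawTwoTopCell stub_prLawTwoMainCell

/-- The `u ≥ 3` rung of Bombieri's `P_r` law for the sections from the KERNEL and the eleven landed glue
stubs (`stub_geThreeCompose`): `EffectiveRoughCellLaw → ∀ t ≥ 1, SectionLevelAt t → ∀ u ≥ 3, SectionPrLawAtU u t`. -/
theorem sectionPrLawGeThree_of_kernel (hKernel : EffectiveRoughCellLaw) :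
    ∀ t : ℕ, 1 ≤ t → SectionLevelAt t → ∀ u : ℕ, 3 ≤ u → SectionPrLawAtU u t :=
  stub_geThreeCompose hKernel stub_sectionSeqBFacts stub_sectionSeqBCells
    stub_sectionDimension stub_sectionDimensionLow stub_sectionMertensLowerHead stub_sectionMertensTwo
    stub_modelDensityAlladi stub_prLawTwoPrep stub_eulerRatio stub_geThreeHyp stub_geThreeReduce
    stub_geThreeMainTerm stub_geThreeAssembly

/-- Bombieri's `P_r` law for the sections at every roughness `u ≥ 2`, from the kernel (case split
`stub_prLawCases` of the two rungs): `EffectiveRoughCellLaw → ∀ t ≥ 1, SectionLevelAt t → SectionPrLawAt t`. -/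
theorem sectionPrLaw_of_kernel (hKernel : EffectiveRoughCellLaw) :
    ∀ t : ℕ, 1 ≤ t → SectionLevelAt t → SectionPrLawAt t :=
  stub_prLawCases sectionPrLawTwo_of_atom (sectionPrLawGeThree_of_kernel hKernel)

/-- The engine from the kernel: `EffectiveRoughCellLaw → ∀ t ≥ 1, SectionLevelAt t → SectionLawAt t`
(Euler-ratio identity + conversion `stub_lawOfPrLaw` + bookkeeping `stub_engineCompose`, all landed). -/
theorem sectionLaw_of_kernel (hKernel : EffectiveRoughCellLaw) :
    ∀ t : ℕ, 1 ≤ t → SectionLevelAt t → SectionLawAt t :=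
  stub_engineCompose stub_eulerRatio (sectionPrLaw_of_kernel hKernel) stub_lawOfPrLaw

/-- **`stub_conditionalClosure`** (registered bookkeeping sub-goal of stmt-Parity-14109, skeleton v15 of the
line `section-annihilator` with its two open stubs turned into hypotheses): the typed tuple-GEH atom for the
section sequences and the effective rough-cell kernel imply `LeeYangFibres.CellParityLaw`. Sorry-free; every
other ingredient is an accepted theorem (reduction `cellParityLaw_of_atom_of_engine` fed with the engine
`sectionLaw_of_kernel`). -/
theorem stub_conditionalClosure :
    (∀ t : ℕ, 1 ≤ t → SectionLevelAt t) → EffectiveRoughCellLaw →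
      Summit.Parity.GeneralizedHardyLittlewood.Theses.LeeYangFibres.CellParityLaw :=
  fun hAtom hKernel => cellParityLaw_of_atom_of_engine hAtom (sectionLaw_of_kernel hKernel)

/-- **Conditional closure of the crux** (curried form of `stub_conditionalClosure`):
`(∀ t ≥ 1, SectionLevelAt t) → EffectiveRoughCellLaw → CellParityLaw`. -/
theorem cellParityLaw_of_atom_of_kernel
    (hAtom : ∀ t : ℕ, 1 ≤ t → SectionLevelAt t) (hKernel : EffectiveRoughCellLaw) :
    Summit.Parity.GeneralizedHardyLittlewood.Theses.LeeYangFibres.CellParityLaw :=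
  stub_conditionalClosure hAtom hKernel

/-- **The `t = 2` layer of the crux from the `t = 1` atom and the kernel.** Pairs of forms (e.g.
`(n, n + h)`, Bombieri's one-parameter law for shifted rough `Ω`-cells, uniformly in `h ≤ LN`) need only the
FIRST instance `SectionLevelAt 1` of the atom — an Elliott–Halberstam-type level statement for shifted rough
`Ω`-cells, one class per modulus — together with the kernel: the Walsh step (`stub_walshStep`, landed) on top
of the unconditional base `stub_base : LawEffAt 1`, then `B = 1`, `N ≥ exp(exp(1/ε))`. -/
theorem cellParityLaw_layer_two_of (hAtom₁ : SectionLevelAt 1) (hKernel : EffectiveRoughCellLaw) :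
    ∀ (L u : ℕ), 2 ≤ u → ∀ ε : ℝ, 0 < ε → ∃ N₀ : ℕ, ∀ N : ℕ, N₀ ≤ N →
      ∀ Ψ : Fin 2 → AffLinForm 1, IsNondegenerateSystem Ψ → affLinSize Ψ N ≤ L →
      ∀ K : Set (Fin 1 → ℝ), Convex ℝ K → K ⊆ realBox 1 N →
      ∃ θ : Finset (Fin 2) → ℝ, θ ∅ = 1 ∧ (∀ S, |θ S| ≤ 2) ∧
        ∀ j : Fin 2 → ℕ, (∀ i, 1 ≤ j i ∧ j i ≤ u) →
          |(cell Ψ K N u j : ℝ) -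
              walsh θ j * (archFactor Ψ K * singularProduct Ψ * ∏ i, modelDensity N u (j i))|
            ≤ ε * N / Real.log N ^ 2 :=
  cellParityLawLayer_of_lawEffAt
    (stub_walshStep stub_modelDensityBounds stub_singularRatio 1 le_rfl
      (sectionLaw_of_kernel hKernel 1 le_rfl hAtom₁) stub_base)

end Summit.Parity.GeneralizedHardyLittlewood.Cruxes.CellParityLaw.SectionAnnihilator

end
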